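import Summits.ValiantsHypothesis.ValiantsHypothesis.Theorems.FeketeSOSFeketeSOSHardPaleyRIPDefs
import Summits.ValiantsHypothesis.ValiantsHypothesis.Theorems.FeketeSOSHard.Negative.TameOperatorCubePattern

/-!
# `FeketeSOS.FeketeSOSHard` (stmt-ValiantsHypothesis-3996) — negative side: `stub_tameOperator` is FALSE

Part 3 of 3 (seat val-width-3996-p5, g3).  The registered stub 3′ of the line `Cruxes/FeketeSOSHard/Lines/paley_rip_v3.lean`,
OPERATOR TAMENESS `T(r,m)` — "for every `ε > 0` there is `K` such that every family of `r` weighted squares supported in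
`S ⊆ [0,p)` whose cyclic pattern has coefficients of modulus `≤ M` can be re-represented by squares supported in `S` with
the same cyclic pattern and archimedean mass `≤ K · r^K · #S^{1+ε} · M`" — is refuted at rank `r = 2`:

* `norm_sq_sum_kernel` / `norm_bilin_le` — Gram isometry and Cauchy–Schwarz: a real kernel with `Σ_s h(s,t)h(s,t') =
  μ²·[t=t']` gives `|Σ_{s,t} h(s,t) g_s g_t| ≤ μ · Σ_s |g_s|²`;
* `dual_sq`, `norm_dual_sq_le` — with part 1's orthogonality `cube_orth`, the dual functional `P ↦ Σ_n z(n) P_n` is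
  `√5^J`-bounded on squares supported in the cube `S J` (`#S J = 2^J`);
* `mass_floor` — with part 2's `dual_patY` (`Σ_n z(n) (Y J)_n = 5^J`) and linearity: EVERY family of weighted squares
  supported in `S J` with pattern `Y J = Π_{i<J}(1 + X^{3^i} − X^{2·3^i})` has mass `≥ √5^J = (#S J)^{log₂ √5}`;
* `rankTwo_cube_mass_floor` — the quantitative statement with the objects instantiated (anonymous recursions; golden
  ratio `φ, ψ` for the factorisation `Y J = U J · V J = ¼(U+V)² − ¼(U−V)²`, so `r = 2`, `M = 1`);
* `stub_tameOperator_false` — `¬ (stub verbatim)`: `ε = 1/8`, `J = 8k`, a prime `p ≥ 3^J` (no wrap-around, so the cyclic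
  identity is exact by degrees), stub mass `≤ K·2^K·512^k` versus floor `625^k`.

So the exponent of operator tameness at rank 2 is at least `log₂ √5 = 1.1609…` (the spread bound `√(#S · ν_p(S))·M` of
`…PaleyRIPSpreadL2` is attained on cubes).  Elementary; no facts, no definitions. [folklore]  Honest framing: this kills
STUB 3′ of ONE line (its composition `FeketeSOSHard_of` needs exponent `1+ε` for small `ε`); the crux `FeketeSOSHard`,
the engine `stub_paleyFlatRIP` (Paley graph conjecture below 1/2) and `VP ≠ VNP` are untouched.
-/

-- `Summit.ValiantsHypothesis.ValiantsHypothesis.…` is the tree's namespace convention (summit = problem here).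
set_option linter.dupNamespace false

namespace Summit.ValiantsHypothesis.ValiantsHypothesis.Theorems.FeketeSOSHard.Negative

open Finset
open scoped BigOperators

noncomputable section

/-! ## The Gram isometry and the bilinear bound -/

section Isometry

open Polynomial

/-- **Gram isometry.**  If the real kernel `h` on `T` satisfies `Σ_s h(s,t) h(s,t') = μ² · [t = t']`, then
`Σ_s |Σ_t h(s,t) g(t)|² = μ² · Σ_t |g(t)|²` for every complex `g`. [folklore] -/
theorem norm_sq_sum_kernel (T : Finset ℕ) (h : ℕ → ℕ → ℝ) (μ : ℝ)
    (horth : ∀ t ∈ T, ∀ t' ∈ T, ∑ s ∈ T, h s t * h s t' = if t = t' then μ ^ 2 else 0) (g : ℕ → ℂ) :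
    ∑ s ∈ T, ‖∑ t ∈ T, (h s t : ℂ) * g t‖ ^ 2 = μ ^ 2 * ∑ t ∈ T, ‖g t‖ ^ 2 := by
  have key : ∀ w : ℂ, ((‖w‖ : ℝ) : ℂ) ^ 2 = w * (starRingEnd ℂ) w := fun w => by
    rw [Complex.mul_conj, Complex.normSq_eq_norm_sq, Complex.ofReal_pow]
  have horthC : ∀ t ∈ T, ∀ t' ∈ T,
      ∑ s ∈ T, (h s t : ℂ) * (h s t' : ℂ) = if t = t' then ((μ ^ 2 : ℝ) : ℂ) else 0 := by
    intro t ht t' ht'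
    have e := horth t ht t' ht'
    by_cases htt : t = t'
    · rw [if_pos htt] at e ⊢; exact_mod_cast e
    · rw [if_neg htt] at e ⊢; exact_mod_cast e
  apply Complex.ofReal_injective
  push_cast
  simp_rw [key, map_sum, map_mul, Complex.conj_ofReal]
  calc ∑ s ∈ T, (∑ t ∈ T, (h s t : ℂ) * g t) * ∑ t ∈ T, (h s t : ℂ) * (starRingEnd ℂ) (g t)
      = ∑ s ∈ T, ∑ t ∈ T, ∑ t' ∈ T, ((h s t : ℂ) * g t) * ((h s t' : ℂ) * (starRingEnd ℂ) (g t')) := by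
        refine sum_congr rfl fun s _ => ?_
        rw [sum_mul_sum]
    _ = ∑ t ∈ T, ∑ t' ∈ T, ∑ s ∈ T, ((h s t : ℂ) * g t) * ((h s t' : ℂ) * (starRingEnd ℂ) (g t')) := by
        rw [sum_comm]
        exact sum_congr rfl fun t _ => sum_comm
    _ = ∑ t ∈ T, ∑ t' ∈ T, (g t * (starRingEnd ℂ) (g t')) * ∑ s ∈ T, (h s t : ℂ) * (h s t' : ℂ) := by
        refine sum_congr rfl fun t _ => sum_congr rfl fun t' _ => ?_
        rw [mul_sum]
        exact sum_congr rfl fun s _ => by ring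
    _ = ∑ t ∈ T, (g t * (starRingEnd ℂ) (g t)) * ((μ ^ 2 : ℝ) : ℂ) := by
        refine sum_congr rfl fun t ht => ?_
        rw [show ∑ t' ∈ T, (g t * (starRingEnd ℂ) (g t')) * ∑ s ∈ T, (h s t : ℂ) * (h s t' : ℂ)
            = ∑ t' ∈ T, (if t = t' then (g t * (starRingEnd ℂ) (g t')) * ((μ ^ 2 : ℝ) : ℂ) else 0) from
            sum_congr rfl fun t' ht' => by rw [horthC t ht t' ht']; split_ifs <;> simp]
        rw [sum_ite_eq, if_pos ht]
    _ = ((μ ^ 2 : ℝ) : ℂ) * ∑ t ∈ T, g t * (starRingEnd ℂ) (g t) := by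
        rw [mul_sum]; exact sum_congr rfl fun t _ => by ring
    _ = (μ : ℂ) ^ 2 * ∑ t ∈ T, g t * (starRingEnd ℂ) (g t) := by push_cast; ring

/-- **Bilinear bound.**  Under the same orthogonality (`μ ≥ 0`), the Hankel-type bilinear form is bounded by `μ` times
the `ℓ²`-mass: `|Σ_{s,t} h(s,t) g(s) g(t)| ≤ μ · Σ_s |g(s)|²` (Cauchy–Schwarz + isometry). [folklore] -/
theorem norm_bilin_le (T : Finset ℕ) (h : ℕ → ℕ → ℝ) (μ : ℝ) (hμ : 0 ≤ μ)
    (horth : ∀ t ∈ T, ∀ t' ∈ T, ∑ s ∈ T, h s t * h s t' = if t = t' then μ ^ 2 else 0) (g : ℕ → ℂ) :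
    ‖∑ s ∈ T, ∑ t ∈ T, (h s t : ℂ) * (g s * g t)‖ ≤ μ * ∑ s ∈ T, ‖g s‖ ^ 2 := by
  set A := ∑ s ∈ T, ‖g s‖ ^ 2 with hA
  have hA0 : 0 ≤ A := sum_nonneg fun s _ => sq_nonneg _
  have hrw : ∑ s ∈ T, ∑ t ∈ T, (h s t : ℂ) * (g s * g t) = ∑ s ∈ T, g s * ∑ t ∈ T, (h s t : ℂ) * g t := by
    refine sum_congr rfl fun s _ => ?_
    rw [mul_sum]; exact sum_congr rfl fun t _ => by ring
  rw [hrw]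
  have h1 : ‖∑ s ∈ T, g s * ∑ t ∈ T, (h s t : ℂ) * g t‖ ≤ ∑ s ∈ T, ‖g s‖ * ‖∑ t ∈ T, (h s t : ℂ) * g t‖ :=
    (norm_sum_le _ _).trans (le_of_eq (sum_congr rfl fun s _ => norm_mul _ _))
  refine h1.trans ?_
  have hcs := sum_mul_sq_le_sq_mul_sq T (fun s => ‖g s‖) (fun s => ‖∑ t ∈ T, (h s t : ℂ) * g t‖)
  rw [norm_sq_sum_kernel T h μ horth g] at hcs
  have hnn : 0 ≤ ∑ s ∈ T, ‖g s‖ * ‖∑ t ∈ T, (h s t : ℂ) * g t‖ :=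
    sum_nonneg fun s _ => mul_nonneg (norm_nonneg _) (norm_nonneg _)
  have hB : (μ * A) ^ 2 = A * (μ ^ 2 * A) := by ring
  calc ∑ s ∈ T, ‖g s‖ * ‖∑ t ∈ T, (h s t : ℂ) * g t‖
      = Real.sqrt ((∑ s ∈ T, ‖g s‖ * ‖∑ t ∈ T, (h s t : ℂ) * g t‖) ^ 2) := (Real.sqrt_sq hnn).symm
    _ ≤ Real.sqrt ((μ * A) ^ 2) := Real.sqrt_le_sqrt (by rw [hB]; exact hcs)
    _ = μ * A := Real.sqrt_sq (mul_nonneg hμ hA0)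

/-- A square supported in `T` as a double Gram sum: `g² = Σ_{s,t ∈ T} g_s g_t X^{s+t}`. [folklore] -/
theorem sq_eq_gram_sum (g : ℂ[X]) (T : Finset ℕ) (hg : g.support ⊆ T) :
    g ^ 2 = ∑ s ∈ T, ∑ t ∈ T, C (g.coeff s * g.coeff t) * X ^ (s + t) := by
  have hgs : g = ∑ s ∈ T, C (g.coeff s) * X ^ s := by
    conv_lhs => rw [as_sum_support_C_mul_X_pow g]
    exact sum_subset hg fun s _ hs => by rw [notMem_support_iff.1 hs, map_zero, zero_mul]
  conv_lhs => rw [hgs]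
  rw [sq, sum_mul_sum]
  refine sum_congr rfl fun s _ => sum_congr rfl fun t _ => ?_
  rw [map_mul, pow_add]; ring

end Isometry

/-! ## The dual functional on squares supported in the cube, and the mass floor -/

section Floor

open Polynomial
open Summit.ValiantsHypothesis.ValiantsHypothesis.Theorems.FeketeSOSHardPaleyRIP

variable (S : ℕ → Finset ℕ) (hS0 : S 0 = {0})
  (hS : ∀ J, S (J + 1) = (range 2 ×ˢ S J).image fun q => 3 ^ J * q.1 + q.2)
  (ζ : ℕ → ℝ) (z : ℕ → ℕ → ℝ) (hζ : ζ 0 = 2 ∧ ζ 1 = 1 ∧ ζ 2 = -2 ∧ ∀ e, 3 ≤ e → ζ e = 0)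
  (hz0 : ∀ n, z 0 n = if n = 0 then 1 else 0) (hz : ∀ J n, z (J + 1) n = ζ (n / 3 ^ J) * z J (n % 3 ^ J))

include hS0 hS in
/-- The dual functional on a square: `Σ_n z(n) (g²)_n = Σ_{s,t ∈ S J} z(s+t) g_s g_t` for `supp g ⊆ S J`. [folklore] -/
theorem dual_sq (J : ℕ) (g : ℂ[X]) (hg : g.support ⊆ S J) :
    ∑ n ∈ range (3 ^ J), (z J n : ℂ) * (g ^ 2).coeff n =
      ∑ s ∈ S J, ∑ t ∈ S J, (z J (s + t) : ℂ) * (g.coeff s * g.coeff t) := by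
  rw [sq_eq_gram_sum g (S J) hg]
  simp_rw [finsetSum_coeff, coeff_C_mul_X_pow]
  calc ∑ n ∈ range (3 ^ J), (z J n : ℂ) * ∑ s ∈ S J, ∑ t ∈ S J, (if n = s + t then g.coeff s * g.coeff t else 0)
      = ∑ n ∈ range (3 ^ J), ∑ s ∈ S J, ∑ t ∈ S J,
          (if n = s + t then (z J n : ℂ) * (g.coeff s * g.coeff t) else 0) := by
        refine sum_congr rfl fun n _ => ?_
        rw [mul_sum]
        refine sum_congr rfl fun s _ => ?_
        rw [mul_sum]
        refine sum_congr rfl fun t _ => ?_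
        split_ifs <;> simp
    _ = ∑ s ∈ S J, ∑ t ∈ S J, ∑ n ∈ range (3 ^ J),
          (if n = s + t then (z J n : ℂ) * (g.coeff s * g.coeff t) else 0) := by
        rw [sum_comm]
        exact sum_congr rfl fun s _ => sum_comm
    _ = ∑ s ∈ S J, ∑ t ∈ S J, (z J (s + t) : ℂ) * (g.coeff s * g.coeff t) := by
        refine sum_congr rfl fun s hs => sum_congr rfl fun t ht => ?_
        rw [sum_ite_eq', if_pos (mem_range.2 (add_lt_of_mem_cube S hS0 hS hs ht))]

include hS0 hS hζ hz0 hz in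
/-- **The dual functional is `√5^J`-bounded on squares supported in the cube**:
`|Σ_n z(n) (g²)_n| ≤ √5^J · Σ_{s ∈ supp g} |g_s|²`. [folklore] -/
theorem norm_dual_sq_le (J : ℕ) (g : ℂ[X]) (hg : g.support ⊆ S J) :
    ‖∑ n ∈ range (3 ^ J), (z J n : ℂ) * (g ^ 2).coeff n‖ ≤ Real.sqrt 5 ^ J * ∑ s ∈ g.support, ‖g.coeff s‖ ^ 2 := by
  rw [dual_sq S hS0 hS z J g hg]
  have hsub : ∑ s ∈ g.support, ‖g.coeff s‖ ^ 2 = ∑ s ∈ S J, ‖g.coeff s‖ ^ 2 :=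
    sum_subset hg fun s _ hs => by rw [notMem_support_iff.1 hs, norm_zero]; ring
  rw [hsub]
  have hsq : ∀ t ∈ S J, ∀ t' ∈ S J,
      ∑ s ∈ S J, z J (s + t) * z J (s + t') = if t = t' then (Real.sqrt 5 ^ J) ^ 2 else 0 := by
    intro t ht t' ht'
    have e := cube_orth ζ z S hS0 hS hζ hz0 hz J ht ht'
    rw [← pow_mul, mul_comm, pow_mul, Real.sq_sqrt (by norm_num : (0 : ℝ) ≤ 5), ← e]
    exact sum_congr rfl fun s _ => by rw [add_comm s t, add_comm s t']
  exact norm_bilin_le (S J) (fun s t => z J (s + t)) (Real.sqrt 5 ^ J) (pow_nonneg (Real.sqrt_nonneg 5) J)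
    hsq (fun s => g.coeff s)

include hS0 hS in
/-- Degrees: a family of squares supported in `S J` has `deg (Σ_j c_j w_j²) < 3^J`. [folklore] -/
theorem natDegree_sum_sq_lt (J s' : ℕ) (c' : Fin s' → ℂ) (w' : Fin s' → ℂ[X])
    (hsupp : ∀ j, (w' j).support ⊆ S J) : (∑ j, C (c' j) * w' j ^ 2).natDegree < 3 ^ J := by
  have hN : 0 < 3 ^ J := pow_pos (by norm_num) J
  have hle : (∑ j, C (c' j) * w' j ^ 2).natDegree ≤ 3 ^ J - 1 := by
    refine natDegree_sum_le_of_forall_le _ _ fun j _ => ?_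
    refine (natDegree_C_mul_le _ _).trans (natDegree_pow_le.trans ?_)
    by_cases h0 : w' j = 0
    · rw [h0, natDegree_zero, mul_zero]; exact Nat.zero_le _
    · have := two_mul_lt_of_mem_cube S hS0 hS (hsupp j (natDegree_mem_support_of_nonzero h0))
      omega
  omega

include hS0 hS hζ hz0 hz in
/-- **Mass floor.**  Every family of weighted squares supported in the cube `S J` whose pattern is `Y J`
has archimedean mass `Σ_j |c_j| ‖w_j‖₂² ≥ √5^J`. [folklore] -/
theorem mass_floor (Y : ℕ → ℂ[X]) (hY0 : Y 0 = 1)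
    (hY : ∀ J, Y (J + 1) = Y J * (1 + X ^ 3 ^ J - X ^ (2 * 3 ^ J)))
    (J s' : ℕ) (c' : Fin s' → ℂ) (w' : Fin s' → ℂ[X]) (hsupp : ∀ j, (w' j).support ⊆ S J)
    (heq : (∑ j, C (c' j) * w' j ^ 2) = Y J) :
    Real.sqrt 5 ^ J ≤ ∑ j, sqMass (c' j) (w' j) := by
  have hL := dual_patY Y ζ z hζ hz0 hz hY0 hY J
  rw [← heq] at hL
  simp_rw [finsetSum_coeff, coeff_C_mul] at hL
  have hL' : ∑ j, c' j * ∑ n ∈ range (3 ^ J), (z J n : ℂ) * (w' j ^ 2).coeff n = 5 ^ J := by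
    rw [← hL]
    simp_rw [mul_sum]
    rw [sum_comm]
    exact sum_congr rfl fun n _ => sum_congr rfl fun j _ => by ring
  have h5 : (5 : ℝ) ^ J ≤ ∑ j, ‖c' j‖ * (Real.sqrt 5 ^ J * ∑ s ∈ (w' j).support, ‖(w' j).coeff s‖ ^ 2) := by
    calc (5 : ℝ) ^ J = ‖((5 : ℂ) ^ J)‖ := by rw [norm_pow]; norm_num
      _ = ‖∑ j, c' j * ∑ n ∈ range (3 ^ J), (z J n : ℂ) * (w' j ^ 2).coeff n‖ := by rw [hL']
      _ ≤ ∑ j, ‖c' j * ∑ n ∈ range (3 ^ J), (z J n : ℂ) * (w' j ^ 2).coeff n‖ := norm_sum_le _ _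
      _ ≤ ∑ j, ‖c' j‖ * (Real.sqrt 5 ^ J * ∑ s ∈ (w' j).support, ‖(w' j).coeff s‖ ^ 2) :=
          sum_le_sum fun j _ => by
            rw [norm_mul]
            exact mul_le_mul_of_nonneg_left (norm_dual_sq_le S hS0 hS ζ z hζ hz0 hz J (w' j) (hsupp j))
              (norm_nonneg _)
  have hre : ∑ j, ‖c' j‖ * (Real.sqrt 5 ^ J * ∑ s ∈ (w' j).support, ‖(w' j).coeff s‖ ^ 2) =
      Real.sqrt 5 ^ J * ∑ j, sqMass (c' j) (w' j) := by
    rw [mul_sum]; exact sum_congr rfl fun j _ => by unfold sqMass; ring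
  rw [hre] at h5
  have hpos : 0 < Real.sqrt 5 ^ J := pow_pos (Real.sqrt_pos.2 (by norm_num)) J
  have h55 : (5 : ℝ) ^ J = Real.sqrt 5 ^ J * Real.sqrt 5 ^ J := by
    rw [← mul_pow, Real.mul_self_sqrt (by norm_num : (0 : ℝ) ≤ 5)]
  rw [h55] at h5
  exact le_of_mul_le_mul_left h5 hpos

end Floor

/-! ## The refutation -/

section Refutation

open Polynomial
open Summit.ValiantsHypothesis.ValiantsHypothesis.Theorems.FeketeSOSHardPaleyRIP

/-- **Quantitative form: the rank-2 cube family.**  For every `J` there are a support `S` with `#S = 2^J`,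
`S ⊂ [0, 3^J)` (indeed `2s < 3^J` on `S`), two weighted squares supported in `S` whose (exact = cyclic for every
`p ≥ 3^J`) pattern `F` has `deg F < 3^J` and all coefficients of modulus `≤ 1`, such that EVERY family of weighted
squares supported in `S` with pattern `F` has mass `≥ √5^J = (#S)^{log₂ √5} = (#S)^{1.1609…}`. [folklore] -/
theorem rankTwo_cube_mass_floor (J : ℕ) :
    ∃ (S : Finset ℕ) (c : Fin 2 → ℂ) (w : Fin 2 → ℂ[X]) (F : ℂ[X]),
      S.card = 2 ^ J ∧ (∀ a ∈ S, 2 * a < 3 ^ J) ∧ (∀ i, (w i).support ⊆ S) ∧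
      (∑ i, C (c i) * w i ^ 2) = F ∧ F.natDegree < 3 ^ J ∧ (∀ n, ‖F.coeff n‖ ≤ 1) ∧
      ∀ (s' : ℕ) (c' : Fin s' → ℂ) (w' : Fin s' → ℂ[X]), (∀ j, (w' j).support ⊆ S) →
        (∑ j, C (c' j) * w' j ^ 2) = F → Real.sqrt 5 ^ J ≤ ∑ j, sqMass (c' j) (w' j) := by
  -- the objects, as anonymous recursions
  let ζ : ℕ → ℝ := fun e => if e = 0 then 2 else if e = 1 then 1 else if e = 2 then -2 else 0
  have hζ : ζ 0 = 2 ∧ ζ 1 = 1 ∧ ζ 2 = -2 ∧ ∀ e, 3 ≤ e → ζ e = 0 := by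
    refine ⟨by simp [ζ], by simp [ζ], by simp [ζ], fun e he => ?_⟩
    simp only [ζ]
    rw [if_neg (by omega), if_neg (by omega), if_neg (by omega)]
  let z : ℕ → ℕ → ℝ := fun J =>
    Nat.rec (motive := fun _ => ℕ → ℝ) (fun n => if n = 0 then 1 else 0)
      (fun J zJ n => ζ (n / 3 ^ J) * zJ (n % 3 ^ J)) J
  have hz0 : ∀ n, z 0 n = if n = 0 then 1 else 0 := fun n => rfl
  have hz : ∀ J n, z (J + 1) n = ζ (n / 3 ^ J) * z J (n % 3 ^ J) := fun J n => rfl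
  let S : ℕ → Finset ℕ := fun J =>
    Nat.rec (motive := fun _ => Finset ℕ) {0} (fun J SJ => (range 2 ×ˢ SJ).image fun q => 3 ^ J * q.1 + q.2) J
  have hS0 : S 0 = {0} := rfl
  have hS : ∀ J, S (J + 1) = (range 2 ×ˢ S J).image fun q => 3 ^ J * q.1 + q.2 := fun J => rfl
  let Y : ℕ → ℂ[X] := fun J =>
    Nat.rec (motive := fun _ => ℂ[X]) 1 (fun J YJ => YJ * (1 + X ^ 3 ^ J - X ^ (2 * 3 ^ J))) J
  have hY0 : Y 0 = 1 := rfl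
  have hY : ∀ J, Y (J + 1) = Y J * (1 + X ^ 3 ^ J - X ^ (2 * 3 ^ J)) := fun J => rfl
  let a : ℂ := ((Real.goldenRatio : ℝ) : ℂ)
  let b : ℂ := ((Real.goldenConj : ℝ) : ℂ)
  have hab : a * b = -1 := by
    simp only [a, b]; exact_mod_cast Real.goldenRatio_mul_goldenConj
  have hab' : a + b = 1 := by
    simp only [a, b]; exact_mod_cast Real.goldenRatio_add_goldenConj
  let U : ℕ → ℂ[X] := fun J => Nat.rec (motive := fun _ => ℂ[X]) 1 (fun J UJ => UJ * (C a - X ^ 3 ^ J)) J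
  let V : ℕ → ℂ[X] := fun J => Nat.rec (motive := fun _ => ℂ[X]) 1 (fun J VJ => VJ * (X ^ 3 ^ J - C b)) J
  have hUV : U J * V J = Y J :=
    patU_mul_patV a b hab hab' Y U V hY0 hY rfl (fun _ => rfl) rfl (fun _ => rfl) J
  refine ⟨S J, ![1 / 4, -1 / 4], ![U J + V J, U J - V J], Y J, card_cube S hS0 hS J,
    fun s hs => two_mul_lt_of_mem_cube S hS0 hS hs,
    support_two_squares_subset _ _ _ (patU_support S hS0 hS a U rfl (fun _ => rfl) J)
      (patV_support S hS0 hS b V rfl (fun _ => rfl) J),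
    by rw [sum_two_squares_eq, hUV], natDegree_patY_lt Y hY0 hY J, norm_patY_coeff_le_one Y hY0 hY J,
    fun s' c' w' hsupp heq => ?_⟩
  exact mass_floor S hS0 hS ζ z hζ hz0 hz Y hY0 hY J s' c' w' hsupp heq

/-- **`stub_tameOperator` is false** (line `Cruxes/FeketeSOSHard/Lines/paley_rip_v3.lean`, stub 3′; the statement inside
`¬ (…)` is the registered stub VERBATIM).  Witness: rank `r = 2` on the dissociated cubes (`rankTwo_cube_mass_floor`):
with `ε = 1/8`, `J = 8k`, `#S = 2^{8k}`, `M = 1`, the stub would give mass `≤ K·2^K·512^k`, while every representation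
has mass `≥ √5^{8k} = 625^k`; `(625/512)^k` is unbounded.  The true exponent of operator tameness at rank 2 is therefore
`≥ log₂ √5 = 1.1609…`, not `1 + ε`. [folklore] -/
theorem stub_tameOperator_false : ¬ (∀ ε : ℝ, 0 < ε → ∃ K : ℝ, 0 < K ∧
    ∀ (p : ℕ) [Fact p.Prime] (r : ℕ) (S : Finset ℕ), (∀ a ∈ S, a < p) →
      ∀ (c : Fin r → ℂ) (w : Fin r → ℂ[X]), (∀ i, (w i).support ⊆ S) →
      ∀ (F : ℂ[X]) (M : ℝ), F.natDegree < p → ((X : ℂ[X]) ^ p - 1 ∣ (∑ i, C (c i) * w i ^ 2) - F) →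
        (∀ n, ‖F.coeff n‖ ≤ M) →
        ∃ (s' : ℕ) (c' : Fin s' → ℂ) (w' : Fin s' → ℂ[X]), (∀ j, (w' j).support ⊆ S) ∧
          ((X : ℂ[X]) ^ p - 1 ∣ (∑ j, C (c' j) * w' j ^ 2) - F) ∧
          (∑ j, sqMass (c' j) (w' j)) ≤ K * (r : ℝ) ^ K * (S.card : ℝ) ^ (1 + ε) * M) := by
  intro hT
  obtain ⟨K, hK, hK'⟩ := hT (1 / 8) (by norm_num)
  obtain ⟨k, hk⟩ := pow_unbounded_of_one_lt (K * (2 : ℝ) ^ K) (by norm_num : (1 : ℝ) < 625 / 512)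
  obtain ⟨S, c, w, F, hcard, hlt, hwS, hrep, hdeg, hcoef, hfloor⟩ := rankTwo_cube_mass_floor (8 * k)
  obtain ⟨p, hpJ, hprime⟩ := Nat.exists_infinite_primes (3 ^ (8 * k))
  haveI : Fact p.Prime := ⟨hprime⟩
  have hSp : ∀ a ∈ S, a < p := fun a ha => by have := hlt a ha; omega
  obtain ⟨s', c', w', hsupp, hdvd, hmass⟩ := hK' p 2 S hSp c w hwS F 1 (hdeg.trans_le hpJ)
    (by rw [hrep, sub_self]; exact dvd_zero _) hcoef
  -- no wrap-around: the cyclic identity is an exact one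
  have hdegS : (∑ j, C (c' j) * w' j ^ 2).natDegree < 3 ^ (8 * k) := by
    have hN : 0 < 3 ^ (8 * k) := pow_pos (by norm_num) _
    have hle : (∑ j, C (c' j) * w' j ^ 2).natDegree ≤ 3 ^ (8 * k) - 1 := by
      refine natDegree_sum_le_of_forall_le _ _ fun j _ => ?_
      refine (natDegree_C_mul_le _ _).trans (natDegree_pow_le.trans ?_)
      by_cases h0 : w' j = 0
      · rw [h0, natDegree_zero, mul_zero]; exact Nat.zero_le _
      · have := hlt _ (hsupp j (natDegree_mem_support_of_nonzero h0))
        omega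
    omega
  have heq : (∑ j, C (c' j) * w' j ^ 2) = F := by
    refine sub_eq_zero.1 (eq_zero_of_dvd_of_natDegree_lt hdvd ?_)
    rw [← C_1, natDegree_X_pow_sub_C]
    refine lt_of_le_of_lt (natDegree_sub_le _ _) (max_lt (hdegS.trans_le hpJ) (hdeg.trans_le hpJ))
  have hlow := hfloor s' c' w' hsupp heq
  -- arithmetic: √5^{8k} = 625^k, (2^{8k})^{9/8} = 512^k
  have h625 : Real.sqrt 5 ^ (8 * k) = (625 : ℝ) ^ k := by
    rw [show 8 * k = 2 * (4 * k) by ring, pow_mul, Real.sq_sqrt (by norm_num : (0 : ℝ) ≤ 5), pow_mul]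
    norm_num
  have h512 : (S.card : ℝ) ^ ((1 : ℝ) + 1 / 8) = (512 : ℝ) ^ k := by
    rw [hcard, Nat.cast_pow, Nat.cast_ofNat, ← Real.rpow_natCast (2 : ℝ) (8 * k),
      ← Real.rpow_mul (by norm_num : (0 : ℝ) ≤ 2),
      show ((8 * k : ℕ) : ℝ) * ((1 : ℝ) + 1 / 8) = ((9 * k : ℕ) : ℝ) by push_cast; ring,
      Real.rpow_natCast, pow_mul]
    norm_num
  rw [h625] at hlow
  rw [h512, Nat.cast_ofNat, mul_one] at hmass
  have hpos : (0 : ℝ) < (512 : ℝ) ^ k := by positivity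
  have hprod : (625 / 512 : ℝ) ^ k * (512 : ℝ) ^ k = (625 : ℝ) ^ k := by
    rw [← mul_pow]; norm_num
  have hlt' : K * (2 : ℝ) ^ K * (512 : ℝ) ^ k < (625 : ℝ) ^ k := by
    rw [← hprod]; exact mul_lt_mul_of_pos_right hk hpos
  linarith

end Refutation

end

end Summit.ValiantsHypothesis.ValiantsHypothesis.Theorems.FeketeSOSHard.Negative
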